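import Mathlib
import HarnessLib

/-!
# Log-convex contraction from `2 × 2` Hankel positivity

Helper file for the support item `RPProbeCriticality` (route `EquipartitionCriticality` of
`YangMills`, item `stmt-QuantumFields-8763`). Pure real analysis, no lattice objects:

* `sq_le_mul_of_quadForm_nonneg` — a positive semi-definite real quadratic form
  `x² p + 2xy q + y² r ≥ 0` has `p, r ≥ 0` and `q² ≤ p r`;
* `logConvex_contraction` — if `a : ℕ → ℝ` has all the forms
  `x² a(n) + 2xy a(n+1) + y² a(n+2)` positive semi-definite (so `a ≥ 0` is log-convex) and
  `a(n) ≤ C e^{-m n}`, then `a(n+1) ≤ e^{-m} a(n)` for every `n`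
  (ratios of a log-convex sequence are non-decreasing once positive; a ratio above `e^{-m}` would
  beat the exponential bound) — the sequence lemma behind "a uniform gap bounds the effective mass
  at every separation" (Glimm–Jaffe 1987 §6; Seiler LNP 159 Ch. 2);
* `logConvex_contraction_iter` — the iterated form `a(s+k) ≤ e^{-m k} a(s)`.

References: J. Glimm, A. Jaffe, *Quantum Physics* (1987), §6.1; E. Seiler, LNP 159 (1982), Ch. 2.
-/

namespace Summit.QuantumFields.YangMills.Theorems.EquipartitionCriticality.RPProbe

open Filter

/-- A positive semi-definite binary quadratic form `x² p + 2xy q + y² r ≥ 0` (all real `x, y`)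
has non-negative diagonal `p, r ≥ 0` and non-negative determinant `q² ≤ p r`. [folklore] -/
theorem sq_le_mul_of_quadForm_nonneg {p q r : ℝ}
    (h : ∀ x y : ℝ, 0 ≤ x ^ 2 * p + 2 * x * y * q + y ^ 2 * r) :
    q ^ 2 ≤ p * r ∧ 0 ≤ p ∧ 0 ≤ r := by
  have hp : 0 ≤ p := by simpa using h 1 0
  have hr : 0 ≤ r := by simpa using h 0 1
  refine ⟨?_, hp, hr⟩
  rcases hp.lt_or_eq with hp' | hp'
  · have h1 := h q (-p)
    nlinarith
  · subst hp'
    have h1 := h (-(r + 1)) q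
    nlinarith [sq_nonneg q]

/-- **Log-convex contraction.** If every form `x² a(n) + 2xy a(n+1) + y² a(n+2)` is positive
semi-definite (so that `a ≥ 0` and `a(n+1)² ≤ a(n) a(n+2)`) and `a(n) ≤ C e^{-m n}` (any real
`m`; the interesting case is `m > 0`), then `a(n+1) ≤ e^{-m} a(n)` for every `n`: once `a(n) > 0` the ratios `a(k+1)/a(k)`, `k ≥ n`, are
non-decreasing, so a ratio `> e^{-m}` forces geometric growth `a(n+k) ≥ r^k a(n)` with
`r e^{m} > 1`, contradicting the exponential bound (Glimm–Jaffe 1987 §6.1; Seiler LNP 159 Ch. 2).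
[folklore] -/
theorem logConvex_contraction {a : ℕ → ℝ} {C m : ℝ}
    (hpsd : ∀ (n : ℕ) (x y : ℝ), 0 ≤ x ^ 2 * a n + 2 * x * y * a (n + 1) + y ^ 2 * a (n + 2))
    (hbd : ∀ n : ℕ, a n ≤ C * Real.exp (-(m * n))) (n : ℕ) :
    a (n + 1) ≤ Real.exp (-m) * a n := by
  have hnn : ∀ k, 0 ≤ a k := fun k => (sq_le_mul_of_quadForm_nonneg (hpsd k)).2.1
  have hdet : ∀ k, a (k + 1) ^ 2 ≤ a k * a (k + 2) := fun k =>
    (sq_le_mul_of_quadForm_nonneg (hpsd k)).1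
  by_contra hcon
  push Not at hcon
  have hpos1 : 0 < a (n + 1) := lt_of_le_of_lt (mul_nonneg (Real.exp_pos _).le (hnn n)) hcon
  have hposn : 0 < a n := by
    rcases (hnn n).lt_or_eq with h | h
    · exact h
    · exfalso
      have h1 := hdet n
      rw [← h, zero_mul] at h1
      nlinarith
  set r : ℝ := a (n + 1) / a n with hr
  have hr_gt : Real.exp (-m) < r := by
    rw [hr, lt_div_iff₀ hposn]
    exact hcon
  have hr_pos : 0 < r := lt_trans (Real.exp_pos _) hr_gt
  -- the ratios propagate: `a (n+k+1) ≥ r a (n+k) > 0`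
  have key : ∀ k : ℕ, 0 < a (n + k) ∧ r * a (n + k) ≤ a (n + k + 1) := by
    intro k
    induction k with
    | zero =>
      refine ⟨by simpa using hposn, ?_⟩
      simp only [add_zero]
      rw [hr, div_mul_cancel₀ _ hposn.ne']
    | succ k ih =>
      obtain ⟨ihpos, ihle⟩ := ih
      have hpos' : 0 < a (n + k + 1) := lt_of_lt_of_le (mul_pos hr_pos ihpos) ihle
      refine ⟨by simpa [add_assoc] using hpos', ?_⟩
      have h1 : a (n + k + 1) ^ 2 ≤ a (n + k) * a (n + k + 2) := hdet (n + k)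
      have h2 : r * a (n + k + 1) * a (n + k) ≤ a (n + k + 2) * a (n + k) := by
        nlinarith [mul_le_mul_of_nonneg_left ihle hpos'.le]
      have h3 : r * a (n + k + 1) ≤ a (n + k + 2) := le_of_mul_le_mul_right h2 ihpos
      simpa [add_assoc] using h3
  -- geometric growth `a (n+k) ≥ r^k a n`
  have geom : ∀ k : ℕ, r ^ k * a n ≤ a (n + k) := by
    intro k
    induction k with
    | zero => simp
    | succ k ih =>
      calc r ^ (k + 1) * a n = r * (r ^ k * a n) := by ring
        _ ≤ r * a (n + k) := mul_le_mul_of_nonneg_left ih hr_pos.le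
        _ ≤ a (n + k + 1) := (key k).2
        _ = a (n + (k + 1)) := by rw [add_assoc]
  -- contradiction with the exponential bound
  have hq : 1 < r * Real.exp m := by
    have h1 := mul_lt_mul_of_pos_right hr_gt (Real.exp_pos m)
    rwa [← Real.exp_add, neg_add_cancel, Real.exp_zero] at h1
  have hbound : ∀ k : ℕ, (r * Real.exp m) ^ k ≤ C * Real.exp (-(m * n)) / a n := by
    intro k
    rw [le_div_iff₀ hposn, mul_pow]
    have h1 := geom k
    have h2 := hbd (n + k)
    have h3 : Real.exp (-(m * ((n + k : ℕ) : ℝ))) =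
        Real.exp (-(m * n)) * (Real.exp m ^ k)⁻¹ := by
      rw [← Real.exp_nat_mul, ← Real.exp_neg, ← Real.exp_add]
      congr 1
      push_cast
      ring
    rw [h3, ← mul_assoc] at h2
    have hEk : 0 < Real.exp m ^ k := pow_pos (Real.exp_pos m) k
    calc r ^ k * Real.exp m ^ k * a n = (r ^ k * a n) * Real.exp m ^ k := by ring
      _ ≤ a (n + k) * Real.exp m ^ k := mul_le_mul_of_nonneg_right h1 hEk.le
      _ ≤ C * Real.exp (-(m * n)) * (Real.exp m ^ k)⁻¹ * Real.exp m ^ k :=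
          mul_le_mul_of_nonneg_right h2 hEk.le
      _ = C * Real.exp (-(m * n)) := by
          rw [mul_assoc, inv_mul_cancel₀ hEk.ne', mul_one]
  obtain ⟨k, hk⟩ := ((tendsto_pow_atTop_atTop_of_one_lt hq).eventually_gt_atTop
    (C * Real.exp (-(m * n)) / a n)).exists
  exact absurd (hbound k) (not_le.2 hk)

/-- **Iterated log-convex contraction**: under the hypotheses of `logConvex_contraction`,
`a(s + k) ≤ e^{-m k} a(s)` for all `s, k` (Glimm–Jaffe 1987 §6.1). [folklore] -/
theorem logConvex_contraction_iter {a : ℕ → ℝ} {C m : ℝ}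
    (hpsd : ∀ (n : ℕ) (x y : ℝ), 0 ≤ x ^ 2 * a n + 2 * x * y * a (n + 1) + y ^ 2 * a (n + 2))
    (hbd : ∀ n : ℕ, a n ≤ C * Real.exp (-(m * n))) (s k : ℕ) :
    a (s + k) ≤ Real.exp (-(m * k)) * a s := by
  induction k with
  | zero => simp
  | succ k ih =>
    calc a (s + (k + 1)) = a (s + k + 1) := by rw [add_assoc]
      _ ≤ Real.exp (-m) * a (s + k) := logConvex_contraction hpsd hbd (s + k)
      _ ≤ Real.exp (-m) * (Real.exp (-(m * k)) * a s) :=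
          mul_le_mul_of_nonneg_left ih (Real.exp_pos _).le
      _ = Real.exp (-(m * (k + 1 : ℕ))) * a s := by
          rw [← mul_assoc, ← Real.exp_add]
          congr 1
          push_cast
          ring

/-- Non-negativity of a sequence all of whose `2 × 2` Hankel forms are positive semi-definite.
[folklore] -/
theorem nonneg_of_quadForm_nonneg {a : ℕ → ℝ}
    (hpsd : ∀ (n : ℕ) (x y : ℝ), 0 ≤ x ^ 2 * a n + 2 * x * y * a (n + 1) + y ^ 2 * a (n + 2))
    (n : ℕ) : 0 ≤ a n :=
  (sq_le_mul_of_quadForm_nonneg (hpsd n)).2.1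

end Summit.QuantumFields.YangMills.Theorems.EquipartitionCriticality.RPProbe
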